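import Summits.QuantumFields.BalabanUV.Beta.GAN24.ExchangeE2E2ChannelValue
import Summits.QuantumFields.BalabanUV.Beta.GAN24.ExitFaceRightFamily

/-!
# `BalabanUV.Beta.GAN24.ExchangeWordCellPairing` — binder row G-an2-4 ∕ (CONV-C), W-slot (α-0), ROW (C) AT LEVELS `j ≥ 1`, steps (2)–(4) of the (γ) hand's memo
# `HOME/b2b-balaban-gan24-formalise-leaf-06/g52/C-LEVELS-GE1.md` §19: **THE REDUCED EE WORD, AT EVERY LEVEL AND FOR A GENERIC LOCAL, FINE-TRANSLATION-COVARIANT STENCIL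
# FAMILY `S`, IS `|box|·c₀σ_j²` TIMES THE CELL PAIRING OF THE TWO TWO-FACE HALF-VERTICES THROUGH THE DRESSED STEP KERNEL** —
# `Σ_{u∈box} Σ'_{y₁} Σ_a j_u(a,y₁)·(X̃♮_j t_R)(a,y₁) = |box|·c₀σ_j²·Σ_{x∈box} Σ_a FF_L(a,x)·(X̃♮_j FF_R)(a,x)`, every `j`, in-block root, every `d`, `Lc ≥ 1`
# (G-an2-4 CRUX TEAM (2), seat `b2b-balaban-gan24-formalise-leaf-06` = the (γ) hand, gen 52; journal INTENT I-leaf06-g52-11)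

NOT IN PRINT; OUR BOOKKEEPING ([folklore] BY NAME: leaf-04's `CoarseBondCellPairing.sum_box_tsum_sum_mul_periodic_of_cov` (regrouping), (W5) `ExitFaceLeftFamily`
(`leftFamily_cov_of_translate`, `summable_leftFamily_mul_of_locStencil`, `tsum_leftFamily_eq_faceface`), (W5)-R `ExitFaceRightFamily` (`rightFamily_translate`,
`exists_abs_rightFamily_le`, `tsum_rightFamily_eq_faceface`), `ExchangeE2E2ChannelTools.dressedStep_apply_periodic`, `ExchangeE2E2ChannelValue.exists_abs_unitK_apply_le`;
0 `def`, 0 cited fact, 0 `def … : Prop`, 0 sorry).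
HONEST FRAMING (cell contract, verbatim): «discharging `BetaPertH` makes Bałaban's UV stability UNCONDITIONAL — a real constructive-QFT result; it is NOT the continuum
limit and NOT the Clay problem.»  HONEST DEPENDENCY (verbatim): «continuum YM on T⁴ ⇐ BetaPertH ∧ nine spine estimates (0/9 proved); BetaPertH ⇐ (D1) ∧ (D4) ∧ CAP+tail;
G-an2-4 gates asym, D1 and NE2/3/4.»
NOTATION: `X̃♮_j = unitK sf sm (coDressKBmAt (toSite r) Lc (KInvStep Lc j))`; `χ_α(y) = [y_α % Lc = Lc−1]`; left family `j_u(a,y₁) = Σ'_y χ_α(y)·vertexOfK X̃♮_j Lc (unitS sf sm S) μ u y y₁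
(inl α)(inl a)`; right family `t_R(b,z) = Σ'_{u′} Σ'_w χ_β(w)·vertexOfK X̃♮_j Lc (unitS sf sm S) ν u′ z w (inl b)(inl β)`; two-face half-vertices `FF_L(a,x) = Σ'_y χ_α(y)·Σ'_t χ_μ(t)·(unitS
sf sm S) μ t y x (inl α)(inl a)`, `FF_R(b,z) = Σ'_w χ_β(w)·Σ'_t χ_ν(t)·(unitS sf sm S) ν t z w (inl b)(inl β)`; `c₀σ_j = (Lc·(sm·sf))·((Lc^{j+1})^{d+2})⁻¹`.
* §1 **`exchangeWord_eq_cellPairing`** — the identity above: regroup the `|box|` first-slot terms into the cell pairing of the resummed left family against the `Lc`-periodic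
  bounded form `A = X̃♮_j t_R` (covariance + periodicity + summability from (W5), (W5)-R, Tools §2, Value §1), then resum both families ((W5) §3, (W5)-R §2).
WHERE IT SITS: this is leaf-04's `EEWordReduced.ee_word_reduced` left side at EVERY level and for ANY admissible `S` (at level 0 with the Wilson table it is their word; at level
`j′+1` with `S = cE • e3OfK Lc G_{j′} (SrecAt … j′)` it is the E-sector EE word of row (C)); splitting `FF_L`, `FF_R` by `ExitFaceHalfVertexSplit` into `Lc⁻¹τ ± (2Lc)⁻¹e` and
evaluating the `e–e` pairing by `ExchangeE2E2ChannelValue.sum_box_channel_sawFace` is the (W6) channel; the three `τ` pairings are (W4)∕(W7). Asserts NO value of Bałaban's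
tables; discharges NOTHING of (C) ∕ (C)sym ∕ (Q-L) ∕ «T2Shape» ∕ «T2Drift» ∕ (hW, hWall); NEVER «G-an2-4 closed» as (CONV-C); NOT D1, NOT `BetaPertH`, NOT continuum, NOT Clay.
2026-08-23; no existing file touched.
-/

noncomputable section

open Finset
open scoped BigOperators
open Literature.MathematicalPhysics.QuantumFieldTheory
open Literature.MathematicalPhysics.QuantumFieldTheory.Balaban1983to89
open Literature.MathematicalPhysics.QuantumFieldTheory.Balaban1983to89.Beta
open ExpKernelCalculus (Site MKer shiftK)
open OneStepResolventKernel (Fib LocStencil)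
open OneStepKernelFamily (KInvStep vertexOfK)
open AffineAveraging (box toSite)
open Summit.QuantumFields.BalabanUV.Beta.AxialDressingRooted (coDressKBmAt one_le_of_neZero)
open Summit.QuantumFields.BalabanUV.Beta.HessKerDressedUnits (unitK unitS)
open Summit.QuantumFields.BalabanUV.Beta.GAN24.CoarseBondCellPairing (sum_box_tsum_sum_mul_periodic_of_cov)
open Summit.QuantumFields.BalabanUV.Beta.GAN24.ExitFaceLeftFamily (leftFamily_cov_of_translate summable_leftFamily_mul_of_locStencil tsum_leftFamily_eq_faceface)
open Summit.QuantumFields.BalabanUV.Beta.GAN24.ExitFaceRightFamily (rightFamily_translate exists_abs_rightFamily_le tsum_rightFamily_eq_faceface)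
open Summit.QuantumFields.BalabanUV.Beta.GAN24.ExchangeE2E2ChannelTools (dressedStep_apply_periodic)
open Summit.QuantumFields.BalabanUV.Beta.GAN24.ExchangeE2E2ChannelValue (exists_abs_unitK_apply_le)

namespace Summit.QuantumFields.BalabanUV.Beta.GAN24.ExchangeWordCellPairing

variable {d : ℕ} {Lc : ℕ} [NeZero Lc] {r : Fin (d + 1) → ℕ}
variable {S : Fin (d + 1) → (Fin (d + 1) → ℤ) → MKer (d + 1) (Fib d)}
variable {μ α ν β : Fin (d + 1)}

/-! ## §1 The reduced EE word as the cell pairing of the two two-face half-vertices -/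

/-- [folklore] **THE REDUCED EE WORD IS `|box|·c₀σ_j²` TIMES THE CELL PAIRING OF THE TWO TWO-FACE HALF-VERTICES THROUGH `X̃♮_j`** (generic local, fine-translation-covariant
`S`; every `j`, in-block root):
`Σ_{u∈box} Σ'_{y₁} Σ_a j_u(a,y₁)·(Σ'_z Σ_b X̃♮_j y₁ z (inl a)(inl b)·t_R(b,z)) = |box|·c₀σ_j²·Σ_{x∈box} Σ_a FF_L(a,x)·(Σ'_z Σ_b X̃♮_j x z (inl a)(inl b)·FF_R(b,z))`. -/
theorem exchangeWord_eq_cellPairing (hr : r ∈ box (d + 1) Lc) {Cs δs : ℝ} (hS : LocStencil S Cs δs) (hδs : 0 < δs)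
    (hSt : ∀ (κ : Fin (d + 1)) (u v : Fin (d + 1) → ℤ), S κ (u + v) = shiftK (-v) (S κ u)) (sf sm : ℝ) (j : ℕ) :
    ∑ u ∈ box (d + 1) Lc, ∑' y₁ : Site (d + 1), ∑ a : Fin (d + 1),
        (∑' y : Site (d + 1), (if y α % (Lc : ℤ) = (Lc : ℤ) - 1 then (1 : ℝ) else 0) *
          vertexOfK (unitK sf sm (coDressKBmAt (toSite r) Lc (KInvStep (d := d) Lc j))) Lc (unitS sf sm S) μ (toSite u) y y₁ (Sum.inl α) (Sum.inl a)) *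
        (∑' z : Site (d + 1), ∑ b : Fin (d + 1), unitK sf sm (coDressKBmAt (toSite r) Lc (KInvStep (d := d) Lc j)) y₁ z (Sum.inl a) (Sum.inl b) *
          (∑' u' : Site (d + 1), ∑' w : Site (d + 1), (if w β % (Lc : ℤ) = (Lc : ℤ) - 1 then (1 : ℝ) else 0) *
            vertexOfK (unitK sf sm (coDressKBmAt (toSite r) Lc (KInvStep (d := d) Lc j))) Lc (unitS sf sm S) ν u' z w (Sum.inl b) (Sum.inl β))) =
      ((box (d + 1) Lc).card : ℝ) * (((Lc : ℝ) * (sm * sf)) * ((((Lc ^ (j + 1) : ℕ) : ℝ)) ^ (d + 1 + 1))⁻¹) ^ 2 *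
        ∑ x ∈ box (d + 1) Lc, ∑ a : Fin (d + 1),
          (∑' y : Site (d + 1), (if y α % (Lc : ℤ) = (Lc : ℤ) - 1 then (1 : ℝ) else 0) *
              ∑' t : Site (d + 1), (if t μ % (Lc : ℤ) = (Lc : ℤ) - 1 then unitS sf sm S μ t y (toSite x) (Sum.inl α) (Sum.inl a) else 0)) *
            ∑' z : Site (d + 1), ∑ b : Fin (d + 1), unitK sf sm (coDressKBmAt (toSite r) Lc (KInvStep (d := d) Lc j)) (toSite x) z (Sum.inl a) (Sum.inl b) *
              (∑' w : Site (d + 1), (if w β % (Lc : ℤ) = (Lc : ℤ) - 1 then (1 : ℝ) else 0) *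
                ∑' t : Site (d + 1), (if t ν % (Lc : ℤ) = (Lc : ℤ) - 1 then unitS sf sm S ν t z w (Sum.inl b) (Sum.inl β) else 0)) := by
  have hLc : 1 ≤ Lc := one_le_of_neZero Lc
  set c₀ : ℝ := ((Lc : ℝ) * (sm * sf)) * ((((Lc ^ (j + 1) : ℕ) : ℝ)) ^ (d + 1 + 1))⁻¹ with hc₀
  -- the right family `t_R`: periodic, bounded
  set tR : Fin (d + 1) → Site (d + 1) → ℝ := fun b z => ∑' u' : Site (d + 1), ∑' w : Site (d + 1), (if w β % (Lc : ℤ) = (Lc : ℤ) - 1 then (1 : ℝ) else 0) *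
    vertexOfK (unitK sf sm (coDressKBmAt (toSite r) Lc (KInvStep (d := d) Lc j))) Lc (unitS sf sm S) ν u' z w (Sum.inl b) (Sum.inl β) with htR
  have htRp : ∀ b z t, tR b (z + (Lc : ℤ) • t) = tR b z := fun b z t => rightFamily_translate (ν := ν) (β := β) hLc hSt sf sm j b z t
  obtain ⟨M, hM⟩ := exists_abs_rightFamily_le (r := r) (ν := ν) (β := β) hLc hSt sf sm j
  have htRB : ∀ b z, |tR b z| ≤ M := fun b z => hM b z
  -- the form `A := X̃ t_R`: periodic, bounded
  set A : Fin (d + 1) → Site (d + 1) → ℝ := fun a y₁ => ∑' z : Site (d + 1), ∑ b : Fin (d + 1),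
    unitK sf sm (coDressKBmAt (toSite r) Lc (KInvStep (d := d) Lc j)) y₁ z (Sum.inl a) (Sum.inl b) * tR b z with hA
  have hAp : ∀ a y₁ t, A a (y₁ + (Lc : ℤ) • t) = A a y₁ := fun a y₁ t => dressedStep_apply_periodic sf sm j htRp (Sum.inl a) y₁ t
  obtain ⟨B', hB'⟩ := exists_abs_unitK_apply_le hr sf sm j htRB
  have hAB : ∀ a y₁, |A a y₁| ≤ B' := fun a y₁ => hB' y₁ a
  -- (3) regroup the `|box|` first-slot terms
  have h3 := sum_box_tsum_sum_mul_periodic_of_cov (N := Lc)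
    (j := fun (u : Site (d + 1)) (a : Fin (d + 1)) (y₁ : Site (d + 1)) => ∑' y : Site (d + 1), (if y α % (Lc : ℤ) = (Lc : ℤ) - 1 then (1 : ℝ) else 0) *
      vertexOfK (unitK sf sm (coDressKBmAt (toSite r) Lc (KInvStep (d := d) Lc j))) Lc (unitS sf sm S) μ u y y₁ (Sum.inl α) (Sum.inl a))
    (A := A) (fun u a y₁ t => leftFamily_cov_of_translate (r := r) (μ := μ) (α := α) hLc hSt sf sm j u a y₁ t) hAp
    (fun u a => summable_leftFamily_mul_of_locStencil (μ := μ) (α := α) hLc hr hS hδs sf sm j (fun y₁ => hAB a y₁) u a)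
  beta_reduce at h3
  rw [h3]
  -- (2) resum the left family, (1) the right family inside `A`
  have hL : ∀ (a : Fin (d + 1)) (x : Fin (d + 1) → ℕ), (∑' v : Site (d + 1), ∑' y : Site (d + 1), (if y α % (Lc : ℤ) = (Lc : ℤ) - 1 then (1 : ℝ) else 0) *
      vertexOfK (unitK sf sm (coDressKBmAt (toSite r) Lc (KInvStep (d := d) Lc j))) Lc (unitS sf sm S) μ v y (toSite x) (Sum.inl α) (Sum.inl a)) =
      c₀ * ∑' y : Site (d + 1), (if y α % (Lc : ℤ) = (Lc : ℤ) - 1 then (1 : ℝ) else 0) *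
        ∑' t : Site (d + 1), (if t μ % (Lc : ℤ) = (Lc : ℤ) - 1 then unitS sf sm S μ t y (toSite x) (Sum.inl α) (Sum.inl a) else 0) :=
    fun a x => tsum_leftFamily_eq_faceface (μ := μ) (α := α) hLc hr hS hδs sf sm j a (toSite x)
  have hR : ∀ (b : Fin (d + 1)) (z : Site (d + 1)), tR b z = c₀ * ∑' w : Site (d + 1), (if w β % (Lc : ℤ) = (Lc : ℤ) - 1 then (1 : ℝ) else 0) *
      ∑' t : Site (d + 1), (if t ν % (Lc : ℤ) = (Lc : ℤ) - 1 then unitS sf sm S ν t z w (Sum.inl b) (Sum.inl β) else 0) :=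
    fun b z => tsum_rightFamily_eq_faceface (ν := ν) (β := β) hLc hr hS hδs sf sm j b z
  have hAval : ∀ (a : Fin (d + 1)) (y₁ : Site (d + 1)), A a y₁ = c₀ * ∑' z : Site (d + 1), ∑ b : Fin (d + 1),
      unitK sf sm (coDressKBmAt (toSite r) Lc (KInvStep (d := d) Lc j)) y₁ z (Sum.inl a) (Sum.inl b) *
        (∑' w : Site (d + 1), (if w β % (Lc : ℤ) = (Lc : ℤ) - 1 then (1 : ℝ) else 0) *
          ∑' t : Site (d + 1), (if t ν % (Lc : ℤ) = (Lc : ℤ) - 1 then unitS sf sm S ν t z w (Sum.inl b) (Sum.inl β) else 0)) := by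
    intro a y₁
    rw [hA, ← tsum_mul_left]
    refine tsum_congr fun z => ?_
    rw [Finset.mul_sum]
    refine Finset.sum_congr rfl fun b _ => ?_
    rw [hR b z]
    ring
  simp_rw [hL, hAval]
  refine (congrArg (fun t : ℝ => ((box (d + 1) Lc).card : ℝ) * t) ?_).trans (mul_assoc _ _ _).symm
  rw [Finset.mul_sum]
  refine Finset.sum_congr rfl fun x _ => ?_
  rw [Finset.mul_sum]
  refine Finset.sum_congr rfl fun a _ => ?_
  ring

end Summit.QuantumFields.BalabanUV.Beta.GAN24.ExchangeWordCellPairing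

end
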